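import Literature.NumberTheory.LFunctions.CharacterHarmonicTails
import Literature.NumberTheory.Sieve.PolyaVinogradovTwoOverPi
import Mathlib.NumberTheory.Harmonic.Bounds
import HarnessLib

/-!
# `|L(1, χ)| ≤ ½ log q + log log q + 2` for primitive characters (Pólya–Vinogradov range, proved)

Topic `Literature/NumberTheory/LFunctions`. Everything here is PROVED; no definitions, no named facts.

The classical partial-summation majoration of `L(1, χ)` in the Pólya–Vinogradov range
(Montgomery–Vaughan, *Multiplicative Number Theory I*, §9.4, proof of Theorem 9.18 ff. and Exercise
11.2.1.3: "`∑_{n > N} χ(n)/n ≪ q^{1/2}(log q)/N`", whence "`|L(1, χ)| ≤ log N + O(1) + O(q^{1/2} log q /N)`"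
and, with `N = q^{1/2} log q`, "`L(1, χ) ≤ (½ + o(1)) log q`"), made explicit with the tree's kernel
Pólya–Vinogradov inequality with constant `2/π`
(`Literature.NumberTheory.Sieve.LargeSieve.polyaVinogradov_two_div_pi`:
`|∑_{A < n ≤ A+N} χ(n)| ≤ W(q) := (2/π)√q log q + (2/5)√q` for primitive `χ` mod `q ≥ 2`) and the tree's
Abel-summation tail bound (`CharacterTails.norm_sum_Icc_div_sub_LFunction_one_le`:
`|∑_{n ≤ N} χ(n)/n − L(1, χ)| ≤ W/(N + 1)` under a window bound `W`):

* `norm_LFunction_one_le_log_window_add_two` — for any `χ ≠ 1` whose character sums over all windows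
  `(A, A + N]` are bounded by `W ≥ 1`: `|L(1, χ)| ≤ log W + 2` (take `N = ⌊W⌋`: the head is at most
  `H_N ≤ 1 + log N ≤ 1 + log W`, the tail at most `W/(N+1) < 1`);
* `norm_LFunction_one_le_log_polyaVinogradov` — primitive `χ` mod `q ≥ 2`:
  `|L(1, χ)| ≤ log((2/π)√q log q + (2/5)√q) + 2`;
* `norm_LFunction_one_le_half_log_add_loglog` — primitive `χ` mod `q ≥ 4`:
  `|L(1, χ)| ≤ ½ log q + log log q + 2` (since `(2/π) log q + 2/5 ≤ log q` for `q ≥ 4`).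

Context in the tree: the elementary bound for ALL `χ ≠ 1` is `|L(1, χ)| ≤ log q`
(`DirichletLOneLogBound.norm_LFunction_one_le_log`, Oesterlé); the sharper `½ log q + C` bounds of
Louboutin / Ramaré (`ExplicitLOneUpperBounds.lean`, `ramare2001_corollary1`) are NAMED FACTS. The present
bound sits between the two (it beats `log q` once `½ log q > log log q + 2`, i.e. `q > 10⁴`) and is what
the Pólya–Vinogradov inequality alone gives; it does NOT reach the `½ log q + O(1)` quality that the
explicit Siegel–Tatuzawa line (Hoffstein 1980 (14), Ji–Lu, Chen) consumes.

## References

* H. L. Montgomery, R. C. Vaughan, *Multiplicative Number Theory I*, CUP 2007, §9.4 (Pólya–Vinogradov)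
  and §11.2.1 Exercise 3. [MontgomeryVaughan2007]
* C. Pomerance, *Remarks on the Pólya–Vinogradov inequality*, Integers 11A (2011), §1 (2).
  [Pomerance2011]
-/

noncomputable section

open Finset Real Complex DirichletCharacter

namespace Literature.NumberTheory.LFunctions

variable {q : ℕ} [NeZero q] {χ : DirichletCharacter ℂ q}

omit [NeZero q] in
/-- The head `|∑_{n=1}^{N} χ(n)/n| ≤ H_N ≤ 1 + log N`. [folklore] -/
private lemma norm_sum_Icc_div_le (χ : DirichletCharacter ℂ q) (N : ℕ) :
    ‖∑ n ∈ Icc 1 N, χ (n : ZMod q) / n‖ ≤ 1 + Real.log N := by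
  have hH := harmonic_le_one_add_log N
  have hcast : ((harmonic N : ℚ) : ℝ) = ∑ n ∈ Icc 1 N, ((n : ℝ))⁻¹ := by
    rw [harmonic_eq_sum_Icc]; push_cast; rfl
  rw [hcast] at hH
  refine (norm_sum_le _ _).trans (le_trans (Finset.sum_le_sum fun n hn ↦ ?_) hH)
  have hn1 : (1 : ℝ) ≤ n := by exact_mod_cast (Finset.mem_Icc.1 hn).1
  rw [norm_div, Complex.norm_natCast]
  have hχn : ‖χ (n : ZMod q)‖ ≤ 1 := χ.norm_le_one _
  rw [div_le_iff₀ (by linarith), inv_mul_cancel₀ (by linarith)]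
  exact hχn

/-- **`|L(1, χ)| ≤ log W + 2` from a uniform window bound `W ≥ 1`** on the character sums
`|∑_{A < n ≤ A+N} χ(n)| ≤ W` (`χ ≠ 1`): partial summation with `N = ⌊W⌋` — head `≤ 1 + log N ≤ 1 + log W`
(`H_N ≤ 1 + log N`), tail `≤ W/(N + 1) ≤ 1`.
[cite: MontgomeryVaughan2007, §11.2.1 Exercise 3(a) and §9.4] -/
theorem norm_LFunction_one_le_log_window_add_two (hχ : χ ≠ 1) {W : ℝ} (hW : 1 ≤ W)
    (hS : ∀ A N : ℕ, ‖∑ n ∈ Ioc A (A + N), χ (n : ZMod q)‖ ≤ W) :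
    ‖χ.LFunction 1‖ ≤ Real.log W + 2 := by
  set N : ℕ := ⌊W⌋₊ with hNdef
  have hW0 : 0 ≤ W := by linarith
  have hN1 : 1 ≤ N := by
    rw [hNdef, Nat.one_le_floor_iff]; exact hW
  have hNW : (N : ℝ) ≤ W := Nat.floor_le hW0
  have hWN : W < (N : ℝ) + 1 := Nat.lt_floor_add_one W
  -- the tail
  have hS' : ∀ n : ℕ, ‖∑ k ∈ Ioc N n, χ (k : ZMod q)‖ ≤ W := by
    intro n
    rcases le_or_gt N n with h | h
    · obtain ⟨m, rfl⟩ := Nat.exists_eq_add_of_le h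
      exact hS N m
    · rw [Finset.Ioc_eq_empty (by omega), Finset.sum_empty, norm_zero]; exact hW0
  have htail := CharacterTails.norm_sum_Icc_div_sub_LFunction_one_le χ hχ hS'
  have htail1 : W / ((N : ℝ) + 1) ≤ 1 := by
    rw [div_le_one (by positivity)]; exact hWN.le
  -- the head
  have hhead := norm_sum_Icc_div_le χ N
  have hlogN : Real.log N ≤ Real.log W :=
    Real.log_le_log (by exact_mod_cast (by omega : 0 < N)) hNW
  -- assembly
  have key : ‖χ.LFunction 1‖ ≤ ‖∑ n ∈ Icc 1 N, χ (n : ZMod q) / n‖ +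
      ‖∑ n ∈ Icc 1 N, χ (n : ZMod q) / n - χ.LFunction 1‖ := by
    rw [← norm_neg (∑ n ∈ Icc 1 N, χ (n : ZMod q) / n - χ.LFunction 1)]
    refine le_trans ?_ (norm_add_le _ _)
    rw [neg_sub, add_sub_cancel]
  linarith

omit [NeZero q] in
/-- `W(q) = (2/π)√q log q + (2/5)√q ≥ 1` for `q ≥ 2`. [folklore] -/
private lemma one_le_pvWindow (hq : 2 ≤ q) :
    (1 : ℝ) ≤ 2 / π * Real.sqrt q * Real.log q + 2 / 5 * Real.sqrt q := by
  have hq2 : (2 : ℝ) ≤ q := by exact_mod_cast hq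
  have hsqrt : (1.41 : ℝ) ≤ Real.sqrt q := by
    refine le_trans ?_ (Real.sqrt_le_sqrt hq2)
    rw [show (1.41 : ℝ) = Real.sqrt (1.41 ^ 2) by rw [Real.sqrt_sq (by norm_num)]]
    exact Real.sqrt_le_sqrt (by norm_num)
  have hlog : (0.6931 : ℝ) ≤ Real.log q :=
    le_trans (by linarith [Real.log_two_gt_d9]) (Real.log_le_log (by norm_num) hq2)
  have hπ : 2 / π ≥ (0.63 : ℝ) := by
    rw [ge_iff_le, le_div_iff₀ Real.pi_pos]; linarith [Real.pi_lt_d2]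
  have h1 : (0.63 : ℝ) * 1.41 * 0.6931 ≤ 2 / π * Real.sqrt q * Real.log q := by
    have := mul_le_mul (mul_le_mul hπ.le hsqrt (by norm_num) (by positivity)) hlog (by norm_num)
      (by positivity)
    linarith
  nlinarith

/-- **`|L(1, χ)| ≤ log((2/π)√q log q + (2/5)√q) + 2` for primitive `χ` modulo `q ≥ 2`** — the window
bound of `norm_LFunction_one_le_log_window_add_two` supplied by the kernel Pólya–Vinogradov
inequality with constant `2/π` (`LargeSieve.polyaVinogradov_two_div_pi`).
[cite: MontgomeryVaughan2007, §9.4 Thm. 9.18 and §11.2.1 Exercise 3] [cite: Pomerance2011, §1 (2)] -/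
theorem norm_LFunction_one_le_log_polyaVinogradov (hq : 2 ≤ q) (hχ : χ.IsPrimitive) :
    ‖χ.LFunction 1‖ ≤ Real.log (2 / π * Real.sqrt q * Real.log q + 2 / 5 * Real.sqrt q) + 2 := by
  have hχ1 : χ ≠ 1 := by
    rintro rfl
    have h1 : (1 : DirichletCharacter ℂ q).conductor = 1 := conductor_one
    have h2 : (1 : DirichletCharacter ℂ q).conductor = q := hχ
    omega
  exact norm_LFunction_one_le_log_window_add_two hχ1 (one_le_pvWindow hq)
    fun A N ↦ Sieve.LargeSieve.polyaVinogradov_two_div_pi hq hχ A N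

/-- **`|L(1, χ)| ≤ ½ log q + log log q + 2` for primitive `χ` modulo `q ≥ 4`** (for `q ≥ 4`,
`(2/π) log q + 2/5 ≤ log q`, so the Pólya–Vinogradov window is at most `√q log q`). Between the tree's
elementary `|L(1,χ)| ≤ log q` (all `χ ≠ 1`) and the named Louboutin–Ramaré `½ log q + C` bounds.
[cite: MontgomeryVaughan2007, §9.4 and §11.2.1 Exercise 3 ("`L(1, χ) ≤ (½ + o(1)) log q`")] -/
theorem norm_LFunction_one_le_half_log_add_loglog (hq : 4 ≤ q) (hχ : χ.IsPrimitive) :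
    ‖χ.LFunction 1‖ ≤ Real.log q / 2 + Real.log (Real.log q) + 2 := by
  have h := norm_LFunction_one_le_log_polyaVinogradov (le_trans (by norm_num) hq) hχ
  have hq4 : (4 : ℝ) ≤ q := by exact_mod_cast hq
  have hq0 : (0 : ℝ) < q := by linarith
  have hlog4 : (1.386 : ℝ) ≤ Real.log q := by
    refine le_trans ?_ (Real.log_le_log (by norm_num) hq4)
    rw [show (4 : ℝ) = 2 ^ 2 by norm_num, Real.log_pow]; push_cast; linarith [Real.log_two_gt_d9]
  have hπ : 2 / π ≤ (0.637 : ℝ) := by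
    rw [div_le_iff₀ Real.pi_pos]; linarith [Real.pi_gt_d2]
  have hsqrt0 : 0 < Real.sqrt q := Real.sqrt_pos.2 hq0
  -- `(2/π) log q + 2/5 ≤ log q`
  have hwin : 2 / π * Real.sqrt q * Real.log q + 2 / 5 * Real.sqrt q ≤ Real.sqrt q * Real.log q := by
    have h1 : 2 / π * Real.log q + 2 / 5 ≤ Real.log q := by
      have := mul_le_mul_of_nonneg_right hπ (by linarith : (0 : ℝ) ≤ Real.log q)
      nlinarith
    nlinarith [mul_le_mul_of_nonneg_left h1 hsqrt0.le]
  have hW1 := one_le_pvWindow (q := q) (le_trans (by norm_num) hq)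
  have hlogW : Real.log (2 / π * Real.sqrt q * Real.log q + 2 / 5 * Real.sqrt q) ≤
      Real.log q / 2 + Real.log (Real.log q) := by
    refine (Real.log_le_log (by linarith) hwin).trans (le_of_eq ?_)
    rw [Real.log_mul hsqrt0.ne' (by linarith), Real.log_sqrt hq0.le]
  linarith

end Literature.NumberTheory.LFunctions
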